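import Literature.NumberTheory.LFunctions.NicolasDivisorFunctionCriterion
import HarnessLib

/-!
# RH-FREE · Ramanujan's superior highly composite numbers: `N_ε = ∏_p p^{⌊1/(p^ε−1)⌋}` maximises `d(M)/M^ε` over all `M ≥ 1`, and its first two "levels" are `ξ#` and `(ξ^{β₂})#`, `ξ = 2^{1/ε}` (Ramanujan 1915 §§32–33; Nicolas 2022 Def. 3.5, (3.8), Def. 3.9, Prop. 3.10); nothing here bears on the truth of RH

Literature-typing tranche `rh-lit-broughan-1` (Broughan vol. 3 ch. 2; PRIMARY: J.-L. Nicolas, *Highly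
composite numbers and the Riemann hypothesis*, Ramanujan J. 57 (2022) 507–550, §3.2–3.3).
Everything here is PROVED and RH-FREE (no named facts).

* `IsSHCParameter ε N` — `ε` is a *parameter* of `N`: `d(M)/M^ε ≤ d(N)/N^ε` for every `M ≥ 1`
  (Nicolas's Def. 3.5 (3.3)); `SuperiorHighlyComposite N` — some `ε > 0` is a parameter of `N`
  (Ramanujan's superior highly composite numbers).
* `shcExponent ε p = ⌊1/(p^ε − 1)⌋` and `shcNumber ε = ∏_{p ≤ 2^{1/ε}} p^{⌊1/(p^ε−1)⌋}` — Ramanujan's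
  explicit maximiser `N_ε` (Nicolas (3.8)).
* `log_card_divisors_sub_le_shcNumber` / **`isSHCParameter_shcNumber`** — for `ε > 0` and every
  `M ≥ 1`, `log d(M) − ε log M ≤ log d(N_ε) − ε log N_ε`, i.e. `ε` is a parameter of `N_ε`; hence
  `superiorHighlyComposite_shcNumber`. Proof as in Ramanujan §33 / Nicolas Prop. 3.7: prime by
  prime, `t ↦ log(t+1) − ε t log p` is unimodal with its maximum at `t = ⌊1/(p^ε − 1)⌋`
  (`log_succ_sub_mul_le`).
* Levels (Nicolas Def. 3.9 (3.12)–(3.13), Prop. 3.10 (3.17)): with `ξ = 2^{1/ε}` (`ε = log 2/log ξ`),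
  `k ≤ ⌊1/(p^ε − 1)⌋ ⟺ p ≤ ξ_k = ξ^{β_k}`, `β_k = log(1 + 1/k)/log 2` (`le_shcExponent_iff_le_rpow`);
  `shcExponent ≤ log ξ/(log 2)²` (`shcExponent_le`); the two-level decompositions
  `log_shcNumber_two_levels`, `log2d_shcNumber_two_levels` (§6).
* §7: the divisibility chain `N_ε ∣ N_{ε'}` (`ε' ≤ ε`, `shcNumber_dvd_shcNumber`),
  `θ(2^{1/ε}) ≤ log N_ε`, and `setOf_superiorHighlyComposite_infinite` (Ramanujan: there are
  infinitely many superior highly composite numbers).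

## References

* S. Ramanujan, *Highly composite numbers*, Proc. London Math. Soc. (2) 14 (1915) 347–409,
  §§32–33 (superior highly composite numbers, `N = ∏ p^{⌊1/(p^ε−1)⌋}`). [Ramanujan1915]
* J.-L. Nicolas, *Highly composite numbers and the Riemann hypothesis*, Ramanujan J. 57 (2022)
  507–550: Def. 3.5 (3.3), Prop. 3.7, (3.8), Def. 3.9 (3.12)–(3.14), Prop. 3.10 (3.15)–(3.17).
  [Nicolas2022HC]
-/

noncomputable section

open Real Finset
open scoped Chebyshev

namespace Literature.NumberTheory.LFunctions

namespace Nicolas2022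

/-! ### §1. Definitions -/

/-- `ε` is a **parameter** of `N`: `d(M)/M^ε ≤ d(N)/N^ε` for every integer `M ≥ 1`
(`d` = number of divisors). [cite: Nicolas2022HC, Def. 3.5 (3.3)] -/
def IsSHCParameter (ε : ℝ) (N : ℕ) : Prop :=
  ∀ M : ℕ, 1 ≤ M →
    (M.divisors.card : ℝ) / (M : ℝ) ^ ε ≤ (N.divisors.card : ℝ) / (N : ℝ) ^ ε

/-- `N` is **superior highly composite** (Ramanujan): some `ε > 0` is a parameter of `N`.
[cite: Nicolas2022HC, Def. 3.5] -/
def SuperiorHighlyComposite (N : ℕ) : Prop :=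
  ∃ ε : ℝ, 0 < ε ∧ IsSHCParameter ε N

/-- Ramanujan's exponent `⌊1/(p^ε − 1)⌋`. [cite: Nicolas2022HC, (3.8)] -/
def shcExponent (ε : ℝ) (p : ℕ) : ℕ :=
  ⌊1 / ((p : ℝ) ^ ε - 1)⌋₊

/-- Ramanujan's `N_ε = ∏_{p ≤ 2^{1/ε}} p^{⌊1/(p^ε − 1)⌋}` (for `p > 2^{1/ε}` the exponent vanishes,
`shcExponent_eq_zero`). [cite: Nicolas2022HC, (3.8)] -/
def shcNumber (ε : ℝ) : ℕ :=
  ∏ p ∈ Nat.primesLE ⌊(2 : ℝ) ^ (1 / ε)⌋₊, p ^ shcExponent ε p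

/-! ### §2. The exponent `⌊1/(p^ε − 1)⌋` -/

/-- `p^ε > 1` for a prime `p` and `ε > 0`. [folklore] -/
private theorem one_lt_prime_rpow {p : ℕ} (hp : p.Prime) {ε : ℝ} (hε : 0 < ε) :
    1 < (p : ℝ) ^ ε :=
  Real.one_lt_rpow (by exact_mod_cast hp.one_lt) hε

/-- `k ≤ ⌊1/(p^ε − 1)⌋ ⟺ p^ε ≤ 1 + 1/k` (`k ≥ 1`). [cite: Nicolas2022HC, Prop. 3.7 (proof)] -/
theorem le_shcExponent_iff {p : ℕ} (hp : p.Prime) {ε : ℝ} (hε : 0 < ε) {k : ℕ} (hk : 1 ≤ k) :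
    k ≤ shcExponent ε p ↔ (p : ℝ) ^ ε ≤ 1 + 1 / k := by
  have hr := one_lt_prime_rpow hp hε
  have hr1 : 0 < (p : ℝ) ^ ε - 1 := by linarith
  have hk0 : (0 : ℝ) < k := by exact_mod_cast hk
  rw [shcExponent, Nat.le_floor_iff (by positivity), le_div_iff₀ hr1]
  constructor
  · intro h
    have : (p : ℝ) ^ ε - 1 ≤ 1 / k := by rw [le_div_iff₀ hk0]; linarith
    linarith
  · intro h
    have : (p : ℝ) ^ ε - 1 ≤ 1 / k := by linarith
    rw [le_div_iff₀ hk0] at this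
    linarith

/-- For `p > 2^{1/ε}` the exponent vanishes. [cite: Nicolas2022HC, (3.8)] -/
theorem shcExponent_eq_zero {p : ℕ} (hp : p.Prime) {ε : ℝ} (hε : 0 < ε)
    (h : (2 : ℝ) ^ (1 / ε) < p) : shcExponent ε p = 0 := by
  by_contra h0
  have h1 : 1 ≤ shcExponent ε p := Nat.one_le_iff_ne_zero.2 h0
  have h2 := (le_shcExponent_iff hp hε le_rfl).1 h1
  have h3 : (2 : ℝ) < (p : ℝ) ^ ε := by
    calc (2 : ℝ) = ((2 : ℝ) ^ (1 / ε)) ^ ε := by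
          rw [← Real.rpow_mul (by norm_num), one_div, inv_mul_cancel₀ hε.ne', Real.rpow_one]
      _ < (p : ℝ) ^ ε := Real.rpow_lt_rpow (by positivity) h hε
  norm_num at h2
  linarith

/-- `⌊1/(p^ε − 1)⌋ ≤ 1/(ε log 2)` (from `p^ε ≥ 2^ε ≥ 1 + ε log 2`). [cite: Nicolas2022HC, (3.14)] -/
theorem shcExponent_le {p : ℕ} (hp : p.Prime) {ε : ℝ} (hε : 0 < ε) :
    (shcExponent ε p : ℝ) ≤ 1 / (ε * Real.log 2) := by
  have hl2 : 0 < Real.log 2 := Real.log_pos one_lt_two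
  have h2 : 1 + ε * Real.log 2 ≤ (p : ℝ) ^ ε := by
    calc 1 + ε * Real.log 2 ≤ Real.exp (ε * Real.log 2) := by
          linarith [Real.add_one_le_exp (ε * Real.log 2)]
      _ = (2 : ℝ) ^ ε := by rw [Real.rpow_def_of_pos (by norm_num), mul_comm]
      _ ≤ (p : ℝ) ^ ε := Real.rpow_le_rpow (by norm_num) (by exact_mod_cast hp.two_le) hε.le
  have hr1 : 0 < (p : ℝ) ^ ε - 1 := by nlinarith
  calc (shcExponent ε p : ℝ) ≤ 1 / ((p : ℝ) ^ ε - 1) := Nat.floor_le (by positivity)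
    _ ≤ 1 / (ε * Real.log 2) := div_le_div_of_nonneg_left zero_le_one (by positivity) (by linarith)

/-- **Prime-by-prime maximisation**: `log(t + 1) − ε t log p ≤ log(e + 1) − ε e log p` with
`e = ⌊1/(p^ε − 1)⌋`, for every `t : ℕ` (the sequence is unimodal with its maximum at `e`).
[cite: Nicolas2022HC, Prop. 3.7 (proof); Ramanujan1915, §33] -/
theorem log_succ_sub_mul_le {p : ℕ} (hp : p.Prime) {ε : ℝ} (hε : 0 < ε) (t : ℕ) :
    Real.log (t + 1) - ε * t * Real.log p ≤
      Real.log (shcExponent ε p + 1) - ε * shcExponent ε p * Real.log p := by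
  set e := shcExponent ε p with he
  have hp0 : (0 : ℝ) < p := by exact_mod_cast hp.pos
  have hlr : Real.log ((p : ℝ) ^ ε) = ε * Real.log p := Real.log_rpow hp0 ε
  have hr := one_lt_prime_rpow hp hε
  -- the sign of consecutive differences
  have hdiff : ∀ s : ℕ, (Real.log ((s + 1 : ℕ) + 1) - ε * (s + 1 : ℕ) * Real.log p) -
      (Real.log (s + 1) - ε * s * Real.log p) =
      Real.log ((s + 2) / ((s + 1) * (p : ℝ) ^ ε)) := by
    intro s
    rw [Real.log_div (by positivity) (by positivity), Real.log_mul (by positivity) (by positivity),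
      hlr]
    push_cast
    ring_nf
  have hup : ∀ s : ℕ, s + 1 ≤ e →
      Real.log (s + 1) - ε * s * Real.log p ≤
        Real.log ((s + 1 : ℕ) + 1) - ε * (s + 1 : ℕ) * Real.log p := by
    intro s hs
    have h1 := (le_shcExponent_iff hp hε (Nat.succ_le_succ (Nat.zero_le s))).1 hs
    have h2 : 0 ≤ Real.log ((s + 2) / ((s + 1) * (p : ℝ) ^ ε)) := by
      refine Real.log_nonneg ?_
      rw [le_div_iff₀ (by positivity), one_mul]
      have e1 : (s + 1 : ℝ) * (1 + 1 / (s + 1 : ℕ)) = s + 2 := by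
        push_cast
        field_simp
        ring
      calc (s + 1 : ℝ) * (p : ℝ) ^ ε ≤ (s + 1) * (1 + 1 / (s + 1 : ℕ)) := by gcongr
        _ = s + 2 := e1
    linarith [hdiff s]
  have hdown : ∀ s : ℕ, e ≤ s →
      Real.log ((s + 1 : ℕ) + 1) - ε * (s + 1 : ℕ) * Real.log p ≤
        Real.log (s + 1) - ε * s * Real.log p := by
    intro s hs
    have h1 : ¬ (p : ℝ) ^ ε ≤ 1 + 1 / (s + 1 : ℕ) := by
      intro h
      have := (le_shcExponent_iff hp hε (Nat.succ_le_succ (Nat.zero_le s))).2 h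
      omega
    have h2 : Real.log ((s + 2) / ((s + 1) * (p : ℝ) ^ ε)) ≤ 0 := by
      refine Real.log_nonpos (by positivity) ?_
      rw [div_le_one (by positivity)]
      have e1 : (s + 1 : ℝ) * (1 + 1 / (s + 1 : ℕ)) = s + 2 := by
        push_cast
        field_simp
        ring
      calc (s + 2 : ℝ) = (s + 1) * (1 + 1 / (s + 1 : ℕ)) := e1.symm
        _ ≤ (s + 1) * (p : ℝ) ^ ε := by
            gcongr
            exact (not_le.1 h1).le
    linarith [hdiff s]
  -- climb to `e` from below, descend to `e` from above
  rcases le_total t e with h | h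
  · -- upward induction from `t` to `e`
    have key : ∀ n, t ≤ n → n ≤ e →
        Real.log (t + 1) - ε * t * Real.log p ≤ Real.log (n + 1) - ε * n * Real.log p := by
      intro n htn
      induction n, htn using Nat.le_induction with
      | base => intro; exact le_rfl
      | succ n hmn ih =>
        intro hn
        have := hup n hn
        push_cast at this ⊢
        exact (ih (by omega)).trans this
    exact key e h le_rfl
  · have key : ∀ n, e ≤ n →
        Real.log (n + 1) - ε * n * Real.log p ≤ Real.log (e + 1) - ε * e * Real.log p := by
      intro n hen
      induction n, hen using Nat.le_induction with
      | base => exact le_rfl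
      | succ n hmn ih =>
        have := hdown n hmn
        push_cast at this ⊢
        exact this.trans ih
    exact key t h

/-- In particular `0 ≤ log(e + 1) − ε e log p` (`t = 0`). [folklore] -/
private theorem shc_term_nonneg {p : ℕ} (hp : p.Prime) {ε : ℝ} (hε : 0 < ε) :
    0 ≤ Real.log (shcExponent ε p + 1) - ε * shcExponent ε p * Real.log p := by
  have := log_succ_sub_mul_le hp hε 0
  simpa using this

/-! ### §3. The number `N_ε`: factorisation, `d(N_ε)`, `log N_ε` -/

/-- `N_ε ≠ 0`. [folklore] -/
private theorem shcNumber_ne_zero (ε : ℝ) : shcNumber ε ≠ 0 :=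
  Finset.prod_ne_zero_iff.2 fun _ hp ↦ pow_ne_zero _ (Nat.prime_of_mem_primesLE hp).ne_zero

/-- `v_p(N_ε) = ⌊1/(p^ε − 1)⌋` for every prime `p` (`ε > 0`). [cite: Nicolas2022HC, (3.8)] -/
theorem factorization_shcNumber {ε : ℝ} (hε : 0 < ε) {p : ℕ} (hp : p.Prime) :
    (shcNumber ε).factorization p = shcExponent ε p := by
  classical
  rw [shcNumber, Nat.factorization_prod
    (fun q hq ↦ pow_ne_zero _ (Nat.prime_of_mem_primesLE hq).ne_zero), Finset.sum_apply']
  have h : ∀ q ∈ Nat.primesLE ⌊(2 : ℝ) ^ (1 / ε)⌋₊,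
      (q ^ shcExponent ε q).factorization p = if p = q then shcExponent ε p else 0 := by
    intro q hq
    rw [(Nat.prime_of_mem_primesLE hq).factorization_pow, Finsupp.single_apply]
    by_cases hqp : q = p
    · subst hqp; simp
    · simp [hqp, Ne.symm hqp]
  rw [Finset.sum_congr rfl h, Finset.sum_ite_eq]
  split_ifs with hmem
  · rfl
  · rw [Nat.mem_primesLE, not_and_or] at hmem
    have hlt : ⌊(2 : ℝ) ^ (1 / ε)⌋₊ < p := by
      rcases hmem with h1 | h1
      · exact not_le.1 h1
      · exact absurd hp h1
    exact (shcExponent_eq_zero hp hε (Nat.lt_of_floor_lt hlt)).symm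

/-- `d(N_ε) = ∏_{p ≤ 2^{1/ε}} (⌊1/(p^ε − 1)⌋ + 1)`. [cite: Nicolas2022HC, Prop. 3.10 (3.16)] -/
theorem card_divisors_shcNumber (ε : ℝ) :
    (shcNumber ε).divisors.card =
      ∏ p ∈ Nat.primesLE ⌊(2 : ℝ) ^ (1 / ε)⌋₊, (shcExponent ε p + 1) := by
  classical
  set P := Nat.primesLE ⌊(2 : ℝ) ^ (1 / ε)⌋₊
  have hcop : (P : Set ℕ).Pairwise (Function.onFun Nat.Coprime fun p ↦ p ^ shcExponent ε p) := by
    intro p hp q hq hpq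
    exact Nat.coprime_pow_primes _ _ (Nat.prime_of_mem_primesLE hp)
      (Nat.prime_of_mem_primesLE hq) hpq
  rw [← ArithmeticFunction.sigma_zero_apply, shcNumber,
    ArithmeticFunction.isMultiplicative_sigma.map_prod _ P hcop]
  refine Finset.prod_congr rfl fun p hp ↦ ?_
  exact ArithmeticFunction.sigma_zero_apply_prime_pow (Nat.prime_of_mem_primesLE hp)

/-- `log N_ε = ∑_{p ≤ 2^{1/ε}} ⌊1/(p^ε − 1)⌋ log p`. [cite: Nicolas2022HC, Prop. 3.10 (3.17)] -/
theorem log_shcNumber (ε : ℝ) :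
    Real.log (shcNumber ε) =
      ∑ p ∈ Nat.primesLE ⌊(2 : ℝ) ^ (1 / ε)⌋₊, (shcExponent ε p : ℝ) * Real.log p := by
  rw [shcNumber, Nat.cast_prod, Real.log_prod]
  · refine Finset.sum_congr rfl fun p _ ↦ ?_
    rw [Nat.cast_pow, Real.log_pow]
  · intro p hp
    exact_mod_cast pow_ne_zero _ (Nat.prime_of_mem_primesLE hp).ne_zero

/-- `log d(N_ε) = ∑_{p ≤ 2^{1/ε}} log(⌊1/(p^ε − 1)⌋ + 1)`. [cite: Nicolas2022HC, Prop. 3.10 (3.16)] -/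
theorem log_card_divisors_shcNumber (ε : ℝ) :
    Real.log ((shcNumber ε).divisors.card) =
      ∑ p ∈ Nat.primesLE ⌊(2 : ℝ) ^ (1 / ε)⌋₊, Real.log ((shcExponent ε p : ℝ) + 1) := by
  rw [card_divisors_shcNumber, Nat.cast_prod, Real.log_prod]
  · refine Finset.sum_congr rfl fun p _ ↦ ?_
    push_cast
    rfl
  · intro p _
    positivity

/-! ### §4. `N_ε` maximises `d(M)/M^ε` (Ramanujan) -/

/-- **`log d(M) − ε log M ≤ log d(N_ε) − ε log N_ε`** for every `M ≥ 1`, `ε > 0`.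
[cite: Nicolas2022HC, Prop. 3.7 and (3.8); Ramanujan1915, §33] -/
theorem log_card_divisors_sub_le_shcNumber {ε : ℝ} (hε : 0 < ε) {M : ℕ} (hM : M ≠ 0) :
    Real.log (M.divisors.card) - ε * Real.log M ≤
      Real.log ((shcNumber ε).divisors.card) - ε * Real.log (shcNumber ε) := by
  classical
  set P := Nat.primesLE ⌊(2 : ℝ) ^ (1 / ε)⌋₊ with hP
  -- left side, prime by prime
  have hL : Real.log (M.divisors.card) - ε * Real.log M =
      ∑ p ∈ M.primeFactors,
        (Real.log ((M.factorization p : ℝ) + 1) - ε * (M.factorization p) * Real.log p) := by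
    rw [Nat.card_divisors hM, Nat.cast_prod, Real.log_prod, Real.log_nat_eq_sum_factorization M,
      Finsupp.sum, Nat.support_factorization, Finset.mul_sum, ← Finset.sum_sub_distrib]
    · refine Finset.sum_congr rfl fun p _ ↦ ?_
      push_cast
      ring
    · intro p _
      positivity
  -- right side, prime by prime
  have hR : Real.log ((shcNumber ε).divisors.card) - ε * Real.log (shcNumber ε) =
      ∑ p ∈ P, (Real.log ((shcExponent ε p : ℝ) + 1) - ε * (shcExponent ε p) * Real.log p) := by
    rw [log_card_divisors_shcNumber, log_shcNumber, Finset.mul_sum, ← Finset.sum_sub_distrib]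
    refine Finset.sum_congr rfl fun p _ ↦ ?_
    ring
  rw [hL, hR]
  calc ∑ p ∈ M.primeFactors,
        (Real.log ((M.factorization p : ℝ) + 1) - ε * (M.factorization p) * Real.log p)
      ≤ ∑ p ∈ M.primeFactors,
          (Real.log ((shcExponent ε p : ℝ) + 1) - ε * (shcExponent ε p) * Real.log p) :=
        Finset.sum_le_sum fun p hp ↦ log_succ_sub_mul_le (Nat.prime_of_mem_primeFactors hp) hε _
    _ ≤ ∑ p ∈ M.primeFactors ∪ P,
          (Real.log ((shcExponent ε p : ℝ) + 1) - ε * (shcExponent ε p) * Real.log p) := by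
        refine Finset.sum_le_sum_of_subset_of_nonneg Finset.subset_union_left fun p hp _ ↦ ?_
        have hpp : p.Prime := by
          rcases Finset.mem_union.1 hp with h | h
          · exact Nat.prime_of_mem_primeFactors h
          · exact Nat.prime_of_mem_primesLE h
        exact shc_term_nonneg hpp hε
    _ = ∑ p ∈ P, (Real.log ((shcExponent ε p : ℝ) + 1) - ε * (shcExponent ε p) * Real.log p) := by
        symm
        refine Finset.sum_subset Finset.subset_union_right fun p hp hnp ↦ ?_
        have hpp : p.Prime := by
          rcases Finset.mem_union.1 hp with h | h
          · exact Nat.prime_of_mem_primeFactors h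
          · exact absurd h hnp
        have hlt : ⌊(2 : ℝ) ^ (1 / ε)⌋₊ < p := by
          rw [hP, Nat.mem_primesLE, not_and_or] at hnp
          rcases hnp with h1 | h1
          · exact not_le.1 h1
          · exact absurd hpp h1
        rw [shcExponent_eq_zero hpp hε (Nat.lt_of_floor_lt hlt)]
        simp

/-- **Ramanujan: `ε` is a parameter of `N_ε`**, i.e. `d(M)/M^ε ≤ d(N_ε)/N_ε^ε` for all `M ≥ 1`.
[cite: Nicolas2022HC, Prop. 3.7, (3.8); Ramanujan1915, §§32–33] -/
theorem isSHCParameter_shcNumber {ε : ℝ} (hε : 0 < ε) : IsSHCParameter ε (shcNumber ε) := by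
  intro M hM
  have hM0 : M ≠ 0 := by omega
  have key := log_card_divisors_sub_le_shcNumber hε hM0
  have e1 : ∀ K : ℕ, K ≠ 0 → (K.divisors.card : ℝ) / (K : ℝ) ^ ε =
      Real.exp (Real.log (K.divisors.card) - ε * Real.log K) := by
    intro K hK
    have hK0 : (0 : ℝ) < K := by exact_mod_cast Nat.pos_of_ne_zero hK
    have hd0 : (0 : ℝ) < K.divisors.card := by
      exact_mod_cast Finset.card_pos.2 ⟨1, Nat.one_mem_divisors.2 hK⟩
    rw [Real.exp_sub, Real.exp_log hd0, Real.rpow_def_of_pos hK0, mul_comm (Real.log K) ε]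
  rw [e1 M hM0, e1 _ (shcNumber_ne_zero ε)]
  exact Real.exp_le_exp.2 key

/-- **`N_ε` is superior highly composite** (`ε > 0`). [cite: Nicolas2022HC, Def. 3.5, (3.8)] -/
theorem superiorHighlyComposite_shcNumber {ε : ℝ} (hε : 0 < ε) :
    SuperiorHighlyComposite (shcNumber ε) :=
  ⟨ε, hε, isSHCParameter_shcNumber hε⟩

/-- Logarithmic form of the maximality, for users: `log d(M) ≤ log d(N_ε) + ε (log M − log N_ε)`.
[cite: Nicolas2022HC, Def. 3.5 (3.3)] -/
theorem log_card_divisors_le_of_shcNumber {ε : ℝ} (hε : 0 < ε) {M : ℕ} (hM : M ≠ 0) :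
    Real.log (M.divisors.card) ≤
      Real.log ((shcNumber ε).divisors.card) + ε * (Real.log M - Real.log (shcNumber ε)) := by
  have := log_card_divisors_sub_le_shcNumber hε hM
  linarith

/-! ### §5. Levels: `ε = log 2/log ξ`, `ξ_k = ξ^{β_k}` -/

/-- `2^{1/ε} = ξ` for `ε = log 2/log ξ`. [cite: Nicolas2022HC, Def. 3.9 (3.12)] -/
theorem two_rpow_one_div (ξ : ℝ) (hξ : 1 < ξ) :
    (2 : ℝ) ^ (1 / (Real.log 2 / Real.log ξ)) = ξ := by
  rw [one_div, inv_div, Real.rpow_def_of_pos two_pos, ← mul_div_assoc,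
    mul_div_cancel_left₀ _ (Real.log_pos one_lt_two).ne', Real.exp_log (by linarith)]

/-- `N_ε = ∏_{p ≤ ξ} p^{⌊1/(p^ε−1)⌋}` for `ε = log 2/log ξ`. [cite: Nicolas2022HC, (3.8), (3.12)] -/
theorem shcNumber_eq_prod {ξ : ℝ} (hξ : 1 < ξ) :
    shcNumber (Real.log 2 / Real.log ξ) =
      ∏ p ∈ Nat.primesLE ⌊ξ⌋₊, p ^ shcExponent (Real.log 2 / Real.log ξ) p := by
  rw [shcNumber, two_rpow_one_div ξ hξ]

/-- **Levels**: for `ε = log 2/log ξ` and `k ≥ 1`, `k ≤ ⌊1/(p^ε − 1)⌋ ⟺ p ≤ ξ^{β_k}`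
(`β_k = log(1 + 1/k)/log 2`, tree `Nicolas2022.beta`). [cite: Nicolas2022HC, Def. 3.9 (3.13), Prop. 3.10 (proof)] -/
theorem le_shcExponent_iff_le_rpow {ξ : ℝ} (hξ : 1 < ξ) {p : ℕ} (hp : p.Prime) {k : ℕ}
    (hk : 1 ≤ k) :
    k ≤ shcExponent (Real.log 2 / Real.log ξ) p ↔ (p : ℝ) ≤ ξ ^ beta k := by
  have hl : 0 < Real.log ξ := Real.log_pos hξ
  have hl2 : 0 < Real.log 2 := Real.log_pos one_lt_two
  have hε : 0 < Real.log 2 / Real.log ξ := div_pos hl2 hl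
  have hp0 : (0 : ℝ) < p := by exact_mod_cast hp.pos
  have hk0 : (0 : ℝ) < k := by exact_mod_cast hk
  rw [le_shcExponent_iff hp hε hk, ← Real.log_le_log_iff (by positivity) (by positivity),
    Real.log_rpow hp0, ← Real.log_le_log_iff hp0 (by positivity), Real.log_rpow (by linarith),
    beta]
  rw [div_mul_eq_mul_div, div_le_iff₀ hl, div_mul_eq_mul_div, le_div_iff₀ hl2]
  constructor <;> intro h <;> linarith

/-- `⌊1/(p^ε − 1)⌋ ≤ log ξ/(log 2)²` for `ε = log 2/log ξ`. [cite: Nicolas2022HC, (3.14)] -/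
theorem shcExponent_le_log {ξ : ℝ} (hξ : 1 < ξ) {p : ℕ} (hp : p.Prime) :
    (shcExponent (Real.log 2 / Real.log ξ) p : ℝ) ≤ Real.log ξ / Real.log 2 ^ 2 := by
  have hl : 0 < Real.log ξ := Real.log_pos hξ
  have hl2 : 0 < Real.log 2 := Real.log_pos one_lt_two
  have := shcExponent_le hp (div_pos hl2 hl)
  refine this.trans (le_of_eq ?_)
  field_simp

/-! ### §6. The first two levels of `N_ε` (`ε = log 2/log ξ`): `ξ#` and `(ξ^{β₂})#` -/

/-- `β₁ = 1`. [cite: Nicolas2022HC, (1.2)] -/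
theorem beta_one : beta 1 = 1 := by
  rw [beta]
  norm_num

/-- `β₃ ≤ β₂ ≤ 1`. [cite: Nicolas2022HC, (1.2)] -/
theorem beta_three_le_two_le_one : beta 3 ≤ beta 2 ∧ beta 2 ≤ 1 := by
  have hl2 : 0 < Real.log 2 := Real.log_pos one_lt_two
  refine ⟨?_, ?_⟩
  · rw [beta, beta]
    gcongr
    norm_num
  · rw [beta, div_le_one hl2]
    exact Real.log_le_log (by norm_num) (by norm_num)

/-- Membership in the `k`-th level set: for a prime `p` and `k ≥ 1`,
`p ≤ ⌊ξ^{β_k}⌋ ⟺ k ≤ ⌊1/(p^ε − 1)⌋`. [cite: Nicolas2022HC, Def. 3.9 (3.13)] -/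
theorem mem_primesLE_level_iff {ξ : ℝ} (hξ : 1 < ξ) {k : ℕ} (hk : 1 ≤ k) {p : ℕ} (hp : p.Prime) :
    p ∈ Nat.primesLE ⌊ξ ^ beta k⌋₊ ↔ k ≤ shcExponent (Real.log 2 / Real.log ξ) p := by
  rw [Nat.mem_primesLE, Nat.le_floor_iff (by positivity), le_shcExponent_iff_le_rpow hξ hp hk]
  exact ⟨fun h ↦ h.1, fun h ↦ ⟨h, hp⟩⟩

/-- **`log N_ε = θ(ξ) + θ(ξ^{β₂}) + E₃`** with
`E₃ = ∑_{p ≤ ξ^{β₃}} (⌊1/(p^ε−1)⌋ − 2) log p`, `ε = log 2/log ξ` (`ξ ≥ 2`): the level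
decomposition `log N = ∑_k θ(ξ_k)` of Prop. 3.10 (3.17), with the levels `k ≥ 3` lumped.
[cite: Nicolas2022HC, Prop. 3.10 (3.15), (3.17)] -/
theorem log_shcNumber_two_levels {ξ : ℝ} (hξ : 2 ≤ ξ) :
    Real.log (shcNumber (Real.log 2 / Real.log ξ)) = θ ξ + θ (ξ ^ beta 2) +
      ∑ p ∈ Nat.primesLE ⌊ξ ^ beta 3⌋₊,
        ((shcExponent (Real.log 2 / Real.log ξ) p : ℝ) - 2) * Real.log p := by
  classical
  have hξ1 : 1 < ξ := by linarith
  obtain ⟨hb32, hb21⟩ := beta_three_le_two_le_one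
  have hP : Nat.primesLE ⌊(2 : ℝ) ^ (1 / (Real.log 2 / Real.log ξ))⌋₊ = Nat.primesLE ⌊ξ⌋₊ := by
    rw [two_rpow_one_div ξ hξ1]
  have h12 : Nat.primesLE ⌊ξ ^ beta 2⌋₊ ⊆ Nat.primesLE ⌊ξ⌋₊ := by
    refine Nat.primesLE_mono (Nat.floor_le_floor ?_)
    calc ξ ^ beta 2 ≤ ξ ^ (1 : ℝ) := Real.rpow_le_rpow_of_exponent_le hξ1.le hb21
      _ = ξ := Real.rpow_one ξ
  have h23 : Nat.primesLE ⌊ξ ^ beta 3⌋₊ ⊆ Nat.primesLE ⌊ξ ^ beta 2⌋₊ :=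
    Nat.primesLE_mono (Nat.floor_le_floor (Real.rpow_le_rpow_of_exponent_le hξ1.le hb32))
  have h1mem : ∀ p ∈ Nat.primesLE ⌊ξ⌋₊, 1 ≤ shcExponent (Real.log 2 / Real.log ξ) p := by
    intro p hp
    have h := (mem_primesLE_level_iff hξ1 le_rfl (Nat.prime_of_mem_primesLE hp)).1
    rw [beta_one, Real.rpow_one] at h
    exact h hp
  set e := shcExponent (Real.log 2 / Real.log ξ) with he
  have hpt : ∀ p ∈ Nat.primesLE ⌊ξ⌋₊, (e p : ℝ) * Real.log p =
      Real.log p + (if p ∈ Nat.primesLE ⌊ξ ^ beta 2⌋₊ then Real.log p else 0) +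
        (if p ∈ Nat.primesLE ⌊ξ ^ beta 3⌋₊ then ((e p : ℝ) - 2) * Real.log p else 0) := by
    intro p hp1
    have hp := Nat.prime_of_mem_primesLE hp1
    have h1 := h1mem p hp1
    by_cases h3 : p ∈ Nat.primesLE ⌊ξ ^ beta 3⌋₊
    · have h2 : p ∈ Nat.primesLE ⌊ξ ^ beta 2⌋₊ := h23 h3
      simp only [h2, h3, if_true]
      ring
    · by_cases h2 : p ∈ Nat.primesLE ⌊ξ ^ beta 2⌋₊
      · have h2' : 2 ≤ e p := (mem_primesLE_level_iff hξ1 (by norm_num) hp).1 h2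
        have h3' : ¬ 3 ≤ e p := fun h ↦ h3 ((mem_primesLE_level_iff hξ1 (by norm_num) hp).2 h)
        have : e p = 2 := by omega
        simp only [h2, h3, if_true, if_false, this]
        push_cast
        ring
      · have h2' : ¬ 2 ≤ e p := fun h ↦ h2 ((mem_primesLE_level_iff hξ1 (by norm_num) hp).2 h)
        have : e p = 1 := by omega
        simp only [h2, h3, if_false, this]
        push_cast
        ring
  rw [log_shcNumber, hP, Finset.sum_congr rfl hpt, Finset.sum_add_distrib, Finset.sum_add_distrib,
    Finset.sum_ite_mem, Finset.sum_ite_mem, Finset.inter_eq_right.2 h12,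
    Finset.inter_eq_right.2 (h23.trans h12), Chebyshev.theta_eq_sum_primesLE,
    Chebyshev.theta_eq_sum_primesLE]

/-- Size of the lumped levels `k ≥ 3` in `log N_ε`:
`0 ≤ E₃ ≤ (log ξ/(log 2)²) θ(ξ^{β₃})`. [cite: Nicolas2022HC, (3.14), Prop. 3.10] -/
theorem sum_level_three_log_bounds {ξ : ℝ} (hξ : 2 ≤ ξ) :
    0 ≤ ∑ p ∈ Nat.primesLE ⌊ξ ^ beta 3⌋₊,
        ((shcExponent (Real.log 2 / Real.log ξ) p : ℝ) - 2) * Real.log p ∧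
      ∑ p ∈ Nat.primesLE ⌊ξ ^ beta 3⌋₊,
        ((shcExponent (Real.log 2 / Real.log ξ) p : ℝ) - 2) * Real.log p ≤
        Real.log ξ / Real.log 2 ^ 2 * θ (ξ ^ beta 3) := by
  have hξ1 : 1 < ξ := by linarith
  have h3 : ∀ p ∈ Nat.primesLE ⌊ξ ^ beta 3⌋₊,
      3 ≤ shcExponent (Real.log 2 / Real.log ξ) p ∧ 0 ≤ Real.log p := by
    intro p hp
    have hpp := Nat.prime_of_mem_primesLE hp
    exact ⟨(mem_primesLE_level_iff hξ1 (by norm_num) hpp).1 hp,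
      Real.log_nonneg (by exact_mod_cast hpp.one_lt.le)⟩
  constructor
  · refine Finset.sum_nonneg fun p hp ↦ ?_
    obtain ⟨h3p, hl⟩ := h3 p hp
    have : (3 : ℝ) ≤ shcExponent (Real.log 2 / Real.log ξ) p := by exact_mod_cast h3p
    exact mul_nonneg (by linarith) hl
  · rw [Chebyshev.theta_eq_sum_primesLE, Finset.mul_sum]
    refine Finset.sum_le_sum fun p hp ↦ ?_
    obtain ⟨-, hl⟩ := h3 p hp
    have := shcExponent_le_log hξ1 (Nat.prime_of_mem_primesLE hp)
    exact mul_le_mul_of_nonneg_right (by linarith) hl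

/-- **`log d(N_ε)/log 2 = π(ξ) + β₂ π(ξ^{β₂}) + D₃/log 2`** with
`D₃ = ∑_{p ≤ ξ^{β₃}} (log(⌊1/(p^ε−1)⌋ + 1) − log 3)`, `ε = log 2/log ξ` (`ξ ≥ 2`): the level
decomposition `log d(N)/log 2 = ∑_k β_k π(ξ_k)` of Prop. 3.10 (3.16), levels `k ≥ 3` lumped.
[cite: Nicolas2022HC, Prop. 3.10 (3.16)] -/
theorem log2d_shcNumber_two_levels {ξ : ℝ} (hξ : 2 ≤ ξ) :
    log2d (shcNumber (Real.log 2 / Real.log ξ)) =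
      (Nat.primeCounting ⌊ξ⌋₊ : ℝ) + beta 2 * Nat.primeCounting ⌊ξ ^ beta 2⌋₊ +
        (∑ p ∈ Nat.primesLE ⌊ξ ^ beta 3⌋₊,
          (Real.log ((shcExponent (Real.log 2 / Real.log ξ) p : ℝ) + 1) - Real.log 3)) /
          Real.log 2 := by
  classical
  have hξ1 : 1 < ξ := by linarith
  have hl2 : 0 < Real.log 2 := Real.log_pos one_lt_two
  obtain ⟨hb32, hb21⟩ := beta_three_le_two_le_one
  have hP : Nat.primesLE ⌊(2 : ℝ) ^ (1 / (Real.log 2 / Real.log ξ))⌋₊ = Nat.primesLE ⌊ξ⌋₊ := by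
    rw [two_rpow_one_div ξ hξ1]
  have h12 : Nat.primesLE ⌊ξ ^ beta 2⌋₊ ⊆ Nat.primesLE ⌊ξ⌋₊ := by
    refine Nat.primesLE_mono (Nat.floor_le_floor ?_)
    calc ξ ^ beta 2 ≤ ξ ^ (1 : ℝ) := Real.rpow_le_rpow_of_exponent_le hξ1.le hb21
      _ = ξ := Real.rpow_one ξ
  have h23 : Nat.primesLE ⌊ξ ^ beta 3⌋₊ ⊆ Nat.primesLE ⌊ξ ^ beta 2⌋₊ :=
    Nat.primesLE_mono (Nat.floor_le_floor (Real.rpow_le_rpow_of_exponent_le hξ1.le hb32))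
  have h1mem : ∀ p ∈ Nat.primesLE ⌊ξ⌋₊, 1 ≤ shcExponent (Real.log 2 / Real.log ξ) p := by
    intro p hp
    have h := (mem_primesLE_level_iff hξ1 le_rfl (Nat.prime_of_mem_primesLE hp)).1
    rw [beta_one, Real.rpow_one] at h
    exact h hp
  set e := shcExponent (Real.log 2 / Real.log ξ) with he
  have hpt : ∀ p ∈ Nat.primesLE ⌊ξ⌋₊, Real.log ((e p : ℝ) + 1) =
      Real.log 2 + (if p ∈ Nat.primesLE ⌊ξ ^ beta 2⌋₊ then Real.log 3 - Real.log 2 else 0) +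
        (if p ∈ Nat.primesLE ⌊ξ ^ beta 3⌋₊ then Real.log ((e p : ℝ) + 1) - Real.log 3 else 0) := by
    intro p hp1
    have hp := Nat.prime_of_mem_primesLE hp1
    have h1 := h1mem p hp1
    by_cases h3 : p ∈ Nat.primesLE ⌊ξ ^ beta 3⌋₊
    · have h2 : p ∈ Nat.primesLE ⌊ξ ^ beta 2⌋₊ := h23 h3
      simp only [h2, h3, if_true]
      ring
    · by_cases h2 : p ∈ Nat.primesLE ⌊ξ ^ beta 2⌋₊
      · have h2' : 2 ≤ e p := (mem_primesLE_level_iff hξ1 (by norm_num) hp).1 h2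
        have h3' : ¬ 3 ≤ e p := fun h ↦ h3 ((mem_primesLE_level_iff hξ1 (by norm_num) hp).2 h)
        have : e p = 2 := by omega
        simp only [h2, h3, if_true, if_false, this]
        norm_num
      · have h2' : ¬ 2 ≤ e p := fun h ↦ h2 ((mem_primesLE_level_iff hξ1 (by norm_num) hp).2 h)
        have : e p = 1 := by omega
        simp only [h2, h3, if_false, this]
        norm_num
  have hb2 : beta 2 = (Real.log 3 - Real.log 2) / Real.log 2 := by
    rw [beta, show (1 : ℝ) + 1 / (2 : ℕ) = 3 / 2 by norm_num, Real.log_div (by norm_num) (by norm_num)]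
  rw [log2d, log_card_divisors_shcNumber, hP, Finset.sum_congr rfl hpt, Finset.sum_add_distrib,
    Finset.sum_add_distrib, Finset.sum_ite_mem, Finset.sum_ite_mem, Finset.inter_eq_right.2 h12,
    Finset.inter_eq_right.2 (h23.trans h12), Finset.sum_const, Finset.sum_const, nsmul_eq_mul,
    nsmul_eq_mul, Nat.primesLE_card_eq_primeCounting, Nat.primesLE_card_eq_primeCounting, hb2]
  field_simp

/-- Size of the lumped levels `k ≥ 3` in `log d(N_ε)`:
`0 ≤ D₃ ≤ π(ξ^{β₃}) log(log ξ/(log 2)² + 1)`. [cite: Nicolas2022HC, (3.14), Prop. 3.10] -/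
theorem sum_level_three_log_succ_bounds {ξ : ℝ} (hξ : 2 ≤ ξ) :
    0 ≤ ∑ p ∈ Nat.primesLE ⌊ξ ^ beta 3⌋₊,
        (Real.log ((shcExponent (Real.log 2 / Real.log ξ) p : ℝ) + 1) - Real.log 3) ∧
      ∑ p ∈ Nat.primesLE ⌊ξ ^ beta 3⌋₊,
        (Real.log ((shcExponent (Real.log 2 / Real.log ξ) p : ℝ) + 1) - Real.log 3) ≤
        (Nat.primeCounting ⌊ξ ^ beta 3⌋₊ : ℝ) * Real.log (Real.log ξ / Real.log 2 ^ 2 + 1) := by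
  have hξ1 : 1 < ξ := by linarith
  have h3 : ∀ p ∈ Nat.primesLE ⌊ξ ^ beta 3⌋₊,
      (3 : ℝ) ≤ shcExponent (Real.log 2 / Real.log ξ) p ∧
        (shcExponent (Real.log 2 / Real.log ξ) p : ℝ) ≤ Real.log ξ / Real.log 2 ^ 2 := by
    intro p hp
    have hpp := Nat.prime_of_mem_primesLE hp
    exact ⟨by exact_mod_cast (mem_primesLE_level_iff hξ1 (by norm_num) hpp).1 hp,
      shcExponent_le_log hξ1 hpp⟩
  constructor
  · refine Finset.sum_nonneg fun p hp ↦ ?_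
    obtain ⟨h3p, -⟩ := h3 p hp
    have := Real.log_le_log (by norm_num) (by linarith : (3 : ℝ) ≤ shcExponent _ p + 1)
    linarith
  · rw [← Nat.primesLE_card_eq_primeCounting, ← nsmul_eq_mul, ← Finset.sum_const]
    refine Finset.sum_le_sum fun p hp ↦ ?_
    obtain ⟨h3p, hle⟩ := h3 p hp
    have h1 := Real.log_le_log (by linarith) (by linarith : (shcExponent _ p : ℝ) + 1 ≤
      Real.log ξ / Real.log 2 ^ 2 + 1)
    have h2 : 0 ≤ Real.log 3 := Real.log_nonneg (by norm_num)
    linarith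

/-! ### §7. Divisibility chain and infinitude -/

/-- Every prime `p ≤ 2^{1/ε}` occurs in `N_ε` (its exponent is `≥ 1`). [cite: Nicolas2022HC, (3.8)] -/
theorem one_le_shcExponent {ε : ℝ} (hε : 0 < ε) {p : ℕ} (hp : p.Prime)
    (h : (p : ℝ) ≤ (2 : ℝ) ^ (1 / ε)) : 1 ≤ shcExponent ε p := by
  rw [le_shcExponent_iff hp hε le_rfl]
  have hp0 : (0 : ℝ) ≤ p := Nat.cast_nonneg _
  calc (p : ℝ) ^ ε ≤ ((2 : ℝ) ^ (1 / ε)) ^ ε := Real.rpow_le_rpow hp0 h hε.le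
    _ = 2 := by rw [← Real.rpow_mul (by norm_num), one_div, inv_mul_cancel₀ hε.ne', Real.rpow_one]
    _ = 1 + 1 / (1 : ℕ) := by norm_num

/-- Every prime `p ≤ 2^{1/ε}` divides `N_ε`. [cite: Nicolas2022HC, (3.8)] -/
theorem dvd_shcNumber_of_prime_le {ε : ℝ} (hε : 0 < ε) {p : ℕ} (hp : p.Prime)
    (h : (p : ℝ) ≤ (2 : ℝ) ^ (1 / ε)) : p ∣ shcNumber ε := by
  have hmem : p ∈ Nat.primesLE ⌊(2 : ℝ) ^ (1 / ε)⌋₊ :=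
    Nat.mem_primesLE.2 ⟨Nat.le_floor h, hp⟩
  have h1 : p ^ shcExponent ε p ∣ shcNumber ε := Finset.dvd_prod_of_mem _ hmem
  exact (dvd_pow_self p (Nat.one_le_iff_ne_zero.1 (one_le_shcExponent hε hp h))).trans h1

/-- The exponents increase as `ε` decreases. [cite: Nicolas2022HC, §3.2 (3.4), Lemma 3.6] -/
theorem shcExponent_anti {ε ε' : ℝ} (hε' : 0 < ε') (h : ε' ≤ ε) {p : ℕ} (hp : p.Prime) :
    shcExponent ε p ≤ shcExponent ε' p := by
  have hr' := one_lt_prime_rpow hp hε'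
  have hp1 : (1 : ℝ) ≤ p := by exact_mod_cast hp.one_lt.le
  have hle : (p : ℝ) ^ ε' ≤ (p : ℝ) ^ ε := Real.rpow_le_rpow_of_exponent_le hp1 h
  unfold shcExponent
  exact Nat.floor_le_floor (div_le_div_of_nonneg_left zero_le_one (by linarith) (by linarith))

/-- **`N_ε ∣ N_{ε'}` for `ε' ≤ ε`**: Ramanujan's numbers form a divisibility chain as the parameter
decreases. [cite: Nicolas2022HC, §3.2 (3.4), Lemma 3.6 (3.9)–(3.10)] -/
theorem shcNumber_dvd_shcNumber {ε ε' : ℝ} (hε' : 0 < ε') (h : ε' ≤ ε) :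
    shcNumber ε ∣ shcNumber ε' := by
  have hε : 0 < ε := hε'.trans_le h
  rw [← Nat.factorization_le_iff_dvd (shcNumber_ne_zero ε) (shcNumber_ne_zero ε')]
  intro p
  by_cases hp : p.Prime
  · rw [factorization_shcNumber hε hp, factorization_shcNumber hε' hp]
    exact shcExponent_anti hε' h hp
  · simp [Nat.factorization_eq_zero_of_not_prime _ hp]

/-- **`log N_ε ≥ θ(2^{1/ε})`** (the first level alone). [cite: Nicolas2022HC, Prop. 3.10 (3.15)] -/
theorem theta_le_log_shcNumber {ε : ℝ} (hε : 0 < ε) :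
    θ ((2 : ℝ) ^ (1 / ε)) ≤ Real.log (shcNumber ε) := by
  rw [log_shcNumber, Chebyshev.theta_eq_sum_primesLE]
  refine Finset.sum_le_sum fun p hp ↦ ?_
  have hpp := Nat.prime_of_mem_primesLE hp
  have hle : (p : ℝ) ≤ (2 : ℝ) ^ (1 / ε) :=
    (Nat.le_floor_iff (by positivity)).1 (Nat.le_of_mem_primesLE hp)
  have h1 : (1 : ℝ) ≤ shcExponent ε p := by exact_mod_cast one_le_shcExponent hε hpp hle
  have hl : 0 ≤ Real.log p := Real.log_nonneg (by exact_mod_cast hpp.one_lt.le)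
  nlinarith

/-- **There are infinitely many superior highly composite numbers** (Ramanujan).
[cite: Nicolas2022HC, §3.2 (the sequence (3.5) of shc numbers); Ramanujan1915, §32] -/
theorem setOf_superiorHighlyComposite_infinite : {N : ℕ | SuperiorHighlyComposite N}.Infinite := by
  refine Set.infinite_of_not_bddAbove ?_
  rintro ⟨M, hM⟩
  obtain ⟨q, hMq, hq⟩ := Nat.exists_infinite_primes (M + 1)
  -- take `ε = 1/q`: then `2^{1/ε} = 2^q ≥ q`, so `q ∣ N_ε` and `N_ε ≥ q > M`
  have hq0 : (0 : ℝ) < q := by exact_mod_cast hq.pos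
  have hε : (0 : ℝ) < 1 / q := by positivity
  have hle : (q : ℝ) ≤ (2 : ℝ) ^ (1 / (1 / (q : ℝ))) := by
    rw [one_div_one_div, Real.rpow_natCast]
    exact_mod_cast (Nat.lt_two_pow_self).le
  have hdvd := dvd_shcNumber_of_prime_le hε hq hle
  have hle' : q ≤ shcNumber (1 / (q : ℝ)) := Nat.le_of_dvd (Nat.pos_of_ne_zero (shcNumber_ne_zero _)) hdvd
  have hmem : shcNumber (1 / (q : ℝ)) ∈ {N : ℕ | SuperiorHighlyComposite N} :=
    superiorHighlyComposite_shcNumber hε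
  have := hM hmem
  omega

end Nicolas2022

end Literature.NumberTheory.LFunctions

end
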